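import Mathlib
import Summits.Ventures.PercRepro2.ReimerIncreasing

/-!
# Reimer's inequality restricted to non-constant traces (blind cell PercRepro2, mine-1)

`reimer_nonconstant` (`MINE-1.md` Theorem 14.4): for increasing events `A`, `B` on the cube `U` and
`I ⊆ U`, Reimer's counting inequality `#{A □ B} ≤ #{S ∈ A, U \ S ∈ B}` stays valid when both sides are
restricted to the configurations whose red part and blue part both meet `I`.  The case `|I| = 2` is
Merkl–Rolles 2013 Cor. 1.2 / van den Berg–Jonasson 2012 Prop. 5 (proved there by collapsing the pair).
Proof: the Bollobás–Leader step of `reimer_increasing` along a coordinate outside `I` does not see the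
constraint (`restricted_of_base`), and on the cube `I` itself the constraint only removes the two
constant configurations, which contribute at least as much to the left side (`base_nonconstant`).
-/

namespace Summit.Ventures.PercRepro2

namespace ReimerCube

variable {E : Type*} [DecidableEq E]

/-! ## Restriction to a constraint on the trace on `I`: the induction on the coordinates outside `I` -/

open Classical in
/-- The Bollobás–Leader induction over coordinates outside `I` carries a constraint `P (S ∩ I)` along:
if the restricted inequality holds on the cube `I` for all increasing pairs, it holds on every
`I ∪ W` with `W` disjoint from `I`. -/
theorem restricted_of_base (I : Finset E) (P : Finset E → Prop)
    (hbase : ∀ (A B : Finset E → Prop), Incr A → Incr B →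
      (I.powerset.filter (fun S => DOcc A B S ∧ P S)).card
        ≤ (I.powerset.filter (fun S => A S ∧ B (I \ S) ∧ P S)).card)
    (W : Finset E) (hW : Disjoint I W) :
    ∀ (A B : Finset E → Prop), Incr A → Incr B →
      ((I ∪ W).powerset.filter (fun S => DOcc A B S ∧ P (S ∩ I))).card
        ≤ ((I ∪ W).powerset.filter (fun S => A S ∧ B ((I ∪ W) \ S) ∧ P (S ∩ I))).card := by
  induction W using Finset.induction_on with
  | empty =>
    intro A B hA hB
    have e1 : (I ∪ ∅).powerset.filter (fun S => DOcc A B S ∧ P (S ∩ I))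
        = I.powerset.filter (fun S => DOcc A B S ∧ P S) := by
      rw [Finset.union_empty]
      apply Finset.filter_congr
      intro S hS
      rw [Finset.inter_eq_left.mpr (Finset.mem_powerset.mp hS)]
    have e2 : (I ∪ ∅).powerset.filter (fun S => A S ∧ B ((I ∪ ∅) \ S) ∧ P (S ∩ I))
        = I.powerset.filter (fun S => A S ∧ B (I \ S) ∧ P S) := by
      rw [Finset.union_empty]
      apply Finset.filter_congr
      intro S hS
      rw [Finset.inter_eq_left.mpr (Finset.mem_powerset.mp hS)]
    rw [e1, e2]
    exact hbase A B hA hB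
  | insert i W hi ih =>
    intro A B hA hB
    have hiI : i ∉ I := fun h => Finset.disjoint_left.mp hW h (Finset.mem_insert_self i W)
    have hW' : Disjoint I W := Finset.disjoint_of_subset_right (Finset.subset_insert i W) hW
    have hiU : i ∉ I ∪ W := by
      rw [Finset.mem_union, not_or]; exact ⟨hiI, hi⟩
    have hQ : ∀ S : Finset E, (insert i S) ∩ I = S ∩ I := by
      intro S
      ext x
      simp only [Finset.mem_inter, Finset.mem_insert]
      constructor
      · rintro ⟨rfl | h1, h2⟩
        · exact absurd h2 hiI
        · exact ⟨h1, h2⟩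
      · rintro ⟨h1, h2⟩
        exact ⟨Or.inr h1, h2⟩
    rw [Finset.union_insert, card_filter_powerset_insert hiU, card_filter_powerset_insert hiU]
    have e1 : (I ∪ W).powerset.filter (fun S => DOcc A B (insert i S) ∧ P ((insert i S) ∩ I))
        = (I ∪ W).powerset.filter
            (fun S => (DOcc A (sec1 i B) S ∨ DOcc (sec1 i A) B S) ∧ P (S ∩ I)) := by
      apply Finset.filter_congr
      intro S hS
      rw [hQ S, dOcc_insert_iff hB (fun h => hiU (Finset.mem_powerset.mp hS h))]
    have e2 : (I ∪ W).powerset.filter (fun S => A S ∧ B (insert i (I ∪ W) \ S) ∧ P (S ∩ I))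
        = (I ∪ W).powerset.filter (fun S => A S ∧ sec1 i B ((I ∪ W) \ S) ∧ P (S ∩ I)) := by
      apply Finset.filter_congr
      intro S hS
      rw [insert_sdiff_of_not_mem' (Finset.mem_powerset.mp hS) hiU]
      rfl
    have e3 : (I ∪ W).powerset.filter
          (fun S => A (insert i S) ∧ B (insert i (I ∪ W) \ insert i S) ∧ P ((insert i S) ∩ I))
        = (I ∪ W).powerset.filter (fun S => sec1 i A S ∧ B ((I ∪ W) \ S) ∧ P (S ∩ I)) := by
      apply Finset.filter_congr
      intro S _
      rw [insert_sdiff_insert' hiU, hQ S]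
      rfl
    rw [e1, e2, e3]
    have h_or : ((I ∪ W).powerset.filter
          (fun S => (DOcc A (sec1 i B) S ∨ DOcc (sec1 i A) B S) ∧ P (S ∩ I))).card
        + ((I ∪ W).powerset.filter
          (fun S => (DOcc A (sec1 i B) S ∧ DOcc (sec1 i A) B S) ∧ P (S ∩ I))).card
        = ((I ∪ W).powerset.filter (fun S => DOcc A (sec1 i B) S ∧ P (S ∩ I))).card
          + ((I ∪ W).powerset.filter (fun S => DOcc (sec1 i A) B S ∧ P (S ∩ I))).card := by
      have f1 : (I ∪ W).powerset.filter
            (fun S => (DOcc A (sec1 i B) S ∨ DOcc (sec1 i A) B S) ∧ P (S ∩ I))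
          = (I ∪ W).powerset.filter (fun S => DOcc A (sec1 i B) S ∧ P (S ∩ I))
            ∪ (I ∪ W).powerset.filter (fun S => DOcc (sec1 i A) B S ∧ P (S ∩ I)) := by
        rw [← Finset.filter_or]
        apply Finset.filter_congr
        intro S _
        tauto
      have f2 : (I ∪ W).powerset.filter
            (fun S => (DOcc A (sec1 i B) S ∧ DOcc (sec1 i A) B S) ∧ P (S ∩ I))
          = (I ∪ W).powerset.filter (fun S => DOcc A (sec1 i B) S ∧ P (S ∩ I))
            ∩ (I ∪ W).powerset.filter (fun S => DOcc (sec1 i A) B S ∧ P (S ∩ I)) := by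
        rw [← Finset.filter_and]
        apply Finset.filter_congr
        intro S _
        tauto
      rw [f1, f2, Finset.card_union_add_card_inter]
    have h_sub : ((I ∪ W).powerset.filter (fun S => DOcc A B S ∧ P (S ∩ I))).card
        ≤ ((I ∪ W).powerset.filter
          (fun S => (DOcc A (sec1 i B) S ∧ DOcc (sec1 i A) B S) ∧ P (S ∩ I))).card := by
      apply Finset.card_le_card
      intro S hS
      rw [Finset.mem_filter] at hS ⊢
      exact ⟨hS.1, ⟨hS.2.1.mono_right (incr_le_sec1 hB i), hS.2.1.mono_left (incr_le_sec1 hA i)⟩,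
        hS.2.2⟩
    have ih1 := ih hW' A (sec1 i B) hA (incr_sec1 hB i)
    have ih2 := ih hW' (sec1 i A) B (incr_sec1 hA i) hB
    omega


/-! ## The base case on the cube `I` itself: Reimer minus the two constant configurations -/

open Classical in
/-- On the cube `I`, removing the two constant configurations `∅` and `I` from both sides of
Reimer's inequality keeps it valid: the constants contribute at least as much to the left side. -/
theorem base_nonconstant (I : Finset E) (A B : Finset E → Prop) (hA : Incr A) (hB : Incr B) :
    (I.powerset.filter (fun S => DOcc A B S ∧ (S.Nonempty ∧ S ≠ I))).card
      ≤ (I.powerset.filter (fun S => A S ∧ B (I \ S) ∧ (S.Nonempty ∧ S ≠ I))).card := by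
  set D := I.powerset.filter (fun S => DOcc A B S) with hD
  set R := I.powerset.filter (fun S => A S ∧ B (I \ S)) with hR
  have hDR : D.card ≤ R.card := reimer_increasing I A B hA hB
  have eD : I.powerset.filter (fun S => DOcc A B S ∧ (S.Nonempty ∧ S ≠ I))
      = D.filter (fun S => S.Nonempty ∧ S ≠ I) := by
    rw [hD, Finset.filter_filter]
  have eR : I.powerset.filter (fun S => A S ∧ B (I \ S) ∧ (S.Nonempty ∧ S ≠ I))
      = R.filter (fun S => S.Nonempty ∧ S ≠ I) := by
    rw [hR, Finset.filter_filter]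
    apply Finset.filter_congr
    intro S _
    tauto
  rw [eD, eR]
  have splitD := Finset.card_filter_add_card_filter_not (s := D)
    (p := fun S => S.Nonempty ∧ S ≠ I)
  have splitR := Finset.card_filter_add_card_filter_not (s := R)
    (p := fun S => S.Nonempty ∧ S ≠ I)
  -- the constant configurations: `¬(S.Nonempty ∧ S ≠ I)` means `S = ∅ ∨ S = I`
  have hconst : ∀ S : Finset E, ¬(S.Nonempty ∧ S ≠ I) ↔ (S = ∅ ∨ S = I) := by
    intro S
    rw [Finset.nonempty_iff_ne_empty]
    tauto
  have key : (R.filter (fun S => ¬(S.Nonempty ∧ S ≠ I))).card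
      ≤ (D.filter (fun S => ¬(S.Nonempty ∧ S ≠ I))).card := by
    by_cases h0 : A ∅ ∧ B ∅
    · apply Finset.card_le_card
      intro S hS
      rw [Finset.mem_filter] at hS ⊢
      refine ⟨?_, hS.2⟩
      rw [hD, Finset.mem_filter]
      refine ⟨(Finset.mem_filter.mp hS.1).1, ∅, ∅, Finset.empty_subset _, Finset.empty_subset _,
        Finset.disjoint_empty_left _, fun T _ => hA (Finset.empty_subset T) h0.1,
        fun T _ => hB (Finset.empty_subset T) h0.2⟩
    · by_cases hRc : (R.filter (fun S => ¬(S.Nonempty ∧ S ≠ I))).Nonempty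
      · -- at most one constant configuration lies in `R`, and then `I ∈ D`
        obtain ⟨S, hS⟩ := hRc
        rw [Finset.mem_filter, hR, Finset.mem_filter, hconst] at hS
        obtain ⟨⟨-, hAS, hBS⟩, hS0⟩ := hS
        have hID : I ∈ D.filter (fun S => ¬(S.Nonempty ∧ S ≠ I)) := by
          rw [Finset.mem_filter, hD, Finset.mem_filter, hconst]
          refine ⟨⟨Finset.mem_powerset.mpr (subset_refl I), ?_⟩, Or.inr rfl⟩
          rcases hS0 with rfl | rfl
          · rw [Finset.sdiff_empty] at hBS
            exact ⟨∅, I, Finset.empty_subset _, subset_refl I, Finset.disjoint_empty_left _,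
              fun T _ => hA (Finset.empty_subset T) hAS, fun T hT => hB hT hBS⟩
          · rw [Finset.sdiff_self] at hBS
            exact ⟨S, ∅, subset_refl S, Finset.empty_subset _, Finset.disjoint_empty_right _,
              fun T hT => hA hT hAS, fun T _ => hB (Finset.empty_subset T) hBS⟩
        have h1 : 1 ≤ (D.filter (fun S => ¬(S.Nonempty ∧ S ≠ I))).card :=
          Finset.card_pos.mpr ⟨I, hID⟩
        have h2 : (R.filter (fun S => ¬(S.Nonempty ∧ S ≠ I))).card ≤ 1 := by
          apply Finset.card_le_one.mpr
          intro a ha b hb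
          rw [Finset.mem_filter, hR, Finset.mem_filter, hconst] at ha hb
          obtain ⟨⟨-, hAa, hBa⟩, ha0⟩ := ha
          obtain ⟨⟨-, hAb, hBb⟩, hb0⟩ := hb
          rcases ha0 with rfl | rfl <;> rcases hb0 with rfl | rfl
          · rfl
          · exfalso
            rw [Finset.sdiff_self] at hBb
            exact h0 ⟨hAa, hBb⟩
          · exfalso
            rw [Finset.sdiff_self] at hBa
            exact h0 ⟨hAb, hBa⟩
          · rfl
        omega
      · rw [Finset.not_nonempty_iff_eq_empty] at hRc
        rw [hRc, Finset.card_empty]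
        exact Nat.zero_le _
  omega

/-! ## Theorem 14.4: Reimer restricted to the colourings in which both colours meet `I` -/

open Classical in
/-- **Reimer restricted to non-constant traces (MINE-1 Theorem 14.4).**  For increasing `A`, `B` on the
cube `U` and any `I ⊆ U`, among the configurations whose red and blue parts both meet `I`:
`#{S : A □ B at S} ≤ #{S : S ∈ A, U \ S ∈ B}`.  (`|I| = 2`: Merkl–Rolles 2013 Cor. 1.2 /
van den Berg–Jonasson 2012 Prop. 5.) -/
theorem reimer_nonconstant (I U : Finset E) (hIU : I ⊆ U) (A B : Finset E → Prop)
    (hA : Incr A) (hB : Incr B) :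
    (U.powerset.filter (fun S => DOcc A B S ∧ ((S ∩ I).Nonempty ∧ S ∩ I ≠ I))).card
      ≤ (U.powerset.filter (fun S => A S ∧ B (U \ S) ∧ ((S ∩ I).Nonempty ∧ S ∩ I ≠ I))).card := by
  have hU : I ∪ (U \ I) = U := Finset.union_sdiff_of_subset hIU
  have h := restricted_of_base I (fun S => S.Nonempty ∧ S ≠ I)
    (fun A B hA hB => by convert base_nonconstant I A B hA hB using 2 <;> congr) (U \ I)
    Finset.disjoint_sdiff A B hA hB
  rw [hU] at h
  convert h using 2 <;> congr

end ReimerCube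

end Summit.Ventures.PercRepro2
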